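import Literature.AnabelianGeometry.EtaleTheta.Discharge.Sec3Thm37Named
import Literature.AnabelianGeometry.EtaleTheta.FrdIVocabulary
import Literature.AlgebraicGeometry.Frobenioids.FrobeniusTypeIsotropic
import Literature.AlgebraicGeometry.Frobenioids.ModelFrobenioidIsFrobenioid
import HarnessLib

/-!
# [EtTh] Theorem 3.7 (i)/(iv) — discharge of the [FrdI] Prop 1.10 (vi) input

Proof-only sequel (theorems only, no definitions) of `Discharge/Sec3Thm37.lean` and
`Discharge/Sec3Thm37Named.lean` (abc-iut-L6-t13). S. Mochizuki, *The étale theta function …*,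
Publ. RIMS **45** (2009) [EtTh], §3, Theorem 3.7, pp. 79–80 = PDF pp. 305–306 of
`paper:doi-10-2977-prims-1234361159`; proof p. 306:

> "(i) … it follows from [Mzk17], Theorem 5.2, (ii), that `C` is of isotropic and model type; the
> fact that `C` is of sub-quasi-Frobenius-trivial type follows from [Mzk17], Proposition 1.10, (vi).
> … (iv) follows formally from [Mzk17], Proposition 1.13, (iii) [since, by assertion (i) …,
> "condition (b)" of loc. cit. is always satisfied by objects of `C`]."

`Sec3Thm37.lean` proved the clause "of sub-quasi-Frobenius-trivial type" of (i) and the slimness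
statement (iv) modulo a hypothesis `hqft` ("every object is quasi-Frobenius-trivial"), recorded there
as the [FrdI] Prop 1.10 (vi) input of the printed proof.  [FrdI] Prop 1.10 (vi) is in the tree in its
general form — `Frobenioids.PreFrobenioid.isOfType_isSubQuasiFrobeniusTrivial_of_isOfIsotropicType`:
*a Frobenioid of isotropic type is of sub-quasi-Frobenius-trivial type*
(`Frobenioids/FrobeniusTypeIsotropic.lean`, [MochizukiFrdI2008] Prop. 1.10 (vi), kurims pp. 35–36) —
so the hypothesis `hqft` is DISCHARGED here, exactly along the printed route:

* `thm37_i_subQuasiFrobeniusTrivial`: Thm 3.7 (i) "of sub-quasi-Frobenius-trivial type" from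
  `hF` ([FrdI] Thm 5.2 (ii): `C → F_Φ` is a Frobenioid) and `hB` (the rational-function monoids
  `B₀^Λ` are group-like, which gives "of isotropic type", `thm37_i_isotropic`) — no `hqft`;
* `slimHypothesisB`: condition (b) of [FrdI] Prop 1.13 (iii) at every object — the co-angular
  pre-step `B → A` from a quasi-Frobenius-trivial `B` supplied by sub-quasi-Frobenius-triviality, `B`
  Frobenius-normalized by L1's `ModelFrobenioid.isFrobeniusNormalized`, and `⋂ₙ O^×(A)ⁿ = 1` (`hdiv`,
  unit-profinite resp. unit-trivial type) — "condition (b) … is always satisfied by objects of `C`";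
* `isSlim_category`, `thm37_iv`: Thm 3.7 (iv) "`D` slim ⟹ `C` slim" (the latter as L2-t3's named
  `Prop` `Thm37_iv`) from `hF`, `hB`, `hdiv` — no `hqft`;
* `isFrobeniusTrivial_of_isGroupLikeObj`: the second sentence of [FrdI] Prop 1.10 (vi) ("every
  group-like object is Frobenius-trivial") at the tempered Frobenioid;
* at the CANONICAL [FrdI] vocabulary `treeCatVocab` (`FrdIVocabulary.lean`), the input `hF` itself is
  L1's PROVED [FrdI] Thm 5.2 (ii) `ModelFrobenioid.isFrobenioid` applied to the data of Def 3.6 (ii)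
  (`isFrobenioid_treeCatVocab`: `Φ` a divisorial monoid on `D` = the field `isDivisorialOn`, `D`
  connected and totally epimorphic = the fields `isConnected`/`isTotallyEpimorphic`, `B` group-like =
  `hB`), modulo ONE residual datum `hBmon : IsMonoidOn B` ("`𝔹` a group-like monoid on `D`",
  [FrdI] Thm 5.2 preamble p. 99 — pull-backs of `B = B₀^Λ|_D ×_{(Φ^{ℝ-log})^gp} Φ^gp` injective and
  bijective along FSM-morphisms — a property of the data `B₀^Λ` that `RealifiedDivisorMonoids` does
  not record); whence `_treeCatVocab` forms of all the above with inputs (`hBmon`, `hB`, `hdiv`) only.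

The remaining conjuncts of L2-t3's named `Thm37_i` ("unit-profinite / model / birationally
Frobenius-normalized type") are fields of the free vocabulary `FrobenioidFacade` and are not touched
(see `Sec3Thm37.lean`).  HONEST FRAMING: refereed pre-IUT material ([EtTh] §3 over [FrdI] §1/§5);
nothing here bears on [IUTchIII] Cor. 3.12; no statement of either paper is strengthened.
-/

namespace Literature.AnabelianGeometry.EtaleTheta

open CategoryTheory Opposite Literature.AlgebraicGeometry.Frobenioids

universe u₀ v₀ u v w

variable {D₀ : Type u₀} [Category.{v₀} D₀] {V : FrdIMonoidStub.{w}}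
  {T : RealifiedDivisorMonoids (D₀ := D₀) V} {D : Type u} [Category.{v} D]

namespace TemperedFrobenioid

section General

variable {VD : FrdICatStub.{u, v, w} D} (C₀ : TemperedFrobenioid T D VD)

/-! ## Theorem 3.7 (i): "of sub-quasi-Frobenius-trivial type", via [FrdI] Prop 1.10 (vi) -/

/-- **Thm 3.7 (i), "of sub-quasi-Frobenius-trivial type"** — "follows from [Mzk17], Proposition
1.10, (vi)" (p. 306): a Frobenioid of isotropic type is of sub-quasi-Frobenius-trivial type (L1's
PROVED `PreFrobenioid.isOfType_isSubQuasiFrobeniusTrivial_of_isOfIsotropicType`), and `C` is of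
isotropic type for group-like `B₀^Λ` (`thm37_i_isotropic`).  Inputs: `hF` ([FrdI] Thm 5.2 (ii):
`C → F_Φ` is a Frobenioid) and `hB` only — the hypothesis `hqft` of
`thm37_i_subQuasiFrobeniusTrivial_of` is discharged. [cite: MochizukiEtTh2009, Thm 3.7 p.79] -/
theorem thm37_i_subQuasiFrobeniusTrivial (hF : PreFrobenioid.IsFrobenioid C₀.toElem)
    (hB : ∀ (Y : D₀ᵒᵖ) (b : T.BΛ.obj Y), IsUnit b) :
    PreFrobenioid.IsOfType (PreFrobenioid.IsSubQuasiFrobeniusTrivial C₀.toElem) :=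
  PreFrobenioid.isOfType_isSubQuasiFrobeniusTrivial_of_isOfIsotropicType hF (C₀.thm37_i_isotropic hB)

/-- The three conjuncts of Thm 3.7 (i) that live in the tree's [FrdI] Def 1.2 vocabulary — "of
isotropic type", "of sub-quasi-Frobenius-trivial type", "but not of group-like type" — together,
from `hF` and `hB` (the conjuncts of L2-t3's named `Thm37_i` over the free `FrobenioidFacade` fields
are not touched). [cite: MochizukiEtTh2009, Thm 3.7 p.79] -/
theorem thm37_i_treeClauses (hF : PreFrobenioid.IsFrobenioid C₀.toElem)
    (hB : ∀ (Y : D₀ᵒᵖ) (b : T.BΛ.obj Y), IsUnit b) :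
    PreFrobenioid.IsOfIsotropicType C₀.toElem ∧
      PreFrobenioid.IsOfType (PreFrobenioid.IsSubQuasiFrobeniusTrivial C₀.toElem) ∧
      ¬ PreFrobenioid.IsOfType (PreFrobenioid.IsGroupLikeObj C₀.toElem) :=
  ⟨C₀.thm37_i_isotropic hB, C₀.thm37_i_subQuasiFrobeniusTrivial hF hB, C₀.thm37_i_not_groupLike⟩

/-- The second sentence of **[FrdI] Prop 1.10 (vi)** at the tempered Frobenioid: every group-like
object of `C` is Frobenius-trivial (L1's PROVED
`PreFrobenioid.isFrobeniusTrivial_of_isGroupLikeObj_of_isOfIsotropicType`, for the Frobenioid `C` of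
isotropic type). [cite: MochizukiFrdI2008, Prop. 1.10(vi) p.35] -/
theorem isFrobeniusTrivial_of_isGroupLikeObj (hF : PreFrobenioid.IsFrobenioid C₀.toElem)
    (hB : ∀ (Y : D₀ᵒᵖ) (b : T.BΛ.obj Y), IsUnit b) {X : C₀.category}
    (hX : PreFrobenioid.IsGroupLikeObj C₀.toElem X) :
    PreFrobenioid.IsFrobeniusTrivial C₀.toElem X :=
  PreFrobenioid.isFrobeniusTrivial_of_isGroupLikeObj_of_isOfIsotropicType hF
    (C₀.thm37_i_isotropic hB) hX

/-! ## Theorem 3.7 (iv): condition (b) of [FrdI] Prop 1.13 (iii), and slimness -/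

/-- "**'condition (b)' of loc. cit. is always satisfied by objects of `C`**" (p. 306): at every object
`A` of the tempered Frobenioid, hypothesis (b) of [FrdI] Prop 1.13 (iii) holds — `⋂ₙ O^×(A)ⁿ = 1`
is `hdiv` (unit-profinite resp. unit-trivial type), and the co-angular pre-step `B → A` from a
quasi-Frobenius-trivial object is the one provided by sub-quasi-Frobenius-triviality (Thm 3.7 (i),
[FrdI] Prop 1.10 (vi)), its domain being Frobenius-normalized as is every object of a model
Frobenioid (L1's `ModelFrobenioid.isFrobeniusNormalized`). [cite: MochizukiEtTh2009, Thm 3.7 p.80] -/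
theorem slimHypothesisB (hF : PreFrobenioid.IsFrobenioid C₀.toElem)
    (hB : ∀ (Y : D₀ᵒᵖ) (b : T.BΛ.obj Y), IsUnit b)
    (hdiv : ∀ (X : C₀.category) (α : Aut X), α ∈ PreFrobenioid.unitsSubgroup C₀.toElem X →
      (∀ n : ℕ+, ∃ β : Aut X, β ∈ PreFrobenioid.unitsSubgroup C₀.toElem X ∧ β ^ (n : ℕ) = α) → α = 1)
    (X : C₀.category) : PreFrobenioid.SlimHypothesisB C₀.toElem X := by
  obtain ⟨B, p, hco, hpre, hqft⟩ := C₀.thm37_i_subQuasiFrobeniusTrivial hF hB X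
  exact
    { eq_one_of_forall_pow := hdiv X
      exists_preStep := ⟨B, p, ⟨hco, hpre⟩, hqft, ModelFrobenioid.isFrobeniusNormalized B⟩ }

/-- **Thm 3.7 (iv)** "`D` slim ⟹ `C` slim", stated directly, from `hF` ([FrdI] Thm 5.2 (ii)), `hB`
(group-like `B₀^Λ`) and `hdiv` (`⋂ₙ O^×(A)ⁿ = 1`): [FrdI] Prop 1.13 (iii) in L1's PROVED form
`PreFrobenioid.isSlim`, condition (b) at every object by `slimHypothesisB` — the hypothesis `hqft` of
`isSlim_category_of` is discharged.  As there, the theorem holds for every monoid type `Λ` under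
`hdiv` (print's `Λ ∈ {ℤ, ℝ}` enters only through `hdiv`). [cite: MochizukiEtTh2009, Thm 3.7 p.80] -/
theorem isSlim_category (hF : PreFrobenioid.IsFrobenioid C₀.toElem)
    (hB : ∀ (Y : D₀ᵒᵖ) (b : T.BΛ.obj Y), IsUnit b)
    (hdiv : ∀ (X : C₀.category) (α : Aut X), α ∈ PreFrobenioid.unitsSubgroup C₀.toElem X →
      (∀ n : ℕ+, ∃ β : Aut X, β ∈ PreFrobenioid.unitsSubgroup C₀.toElem X ∧ β ^ (n : ℕ) = α) → α = 1)
    (hD : IsSlim D) : IsSlim C₀.category :=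
  PreFrobenioid.isSlim hF hD fun X => Or.inr (C₀.slimHypothesisB hF hB hdiv X)

/-- **Thm 3.7 (iv)** as L2-t3's named `Prop` `Thm37_iv` ("If `D` is slim, and `Λ ∈ {ℤ, ℝ}`, then `C`
is also slim"), from `hF`, `hB`, `hdiv` — the hypothesis `hqft` of `thm37_iv_of` is discharged.
[cite: MochizukiEtTh2009, Thm 3.7 p.80] -/
theorem thm37_iv (hF : PreFrobenioid.IsFrobenioid C₀.toElem)
    (hB : ∀ (Y : D₀ᵒᵖ) (b : T.BΛ.obj Y), IsUnit b)
    (hdiv : ∀ (X : C₀.category) (α : Aut X), α ∈ PreFrobenioid.unitsSubgroup C₀.toElem X →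
      (∀ n : ℕ+, ∃ β : Aut X, β ∈ PreFrobenioid.unitsSubgroup C₀.toElem X ∧ β ^ (n : ℕ) = α) → α = 1) :
    C₀.Thm37_iv :=
  fun hD _ => C₀.isSlim_category hF hB hdiv hD

end General

/-! ## At the canonical [FrdI] vocabulary: `hF` is L1's [FrdI] Thm 5.2 (ii) -/

section TreeVocab

variable {IsRational IsStrictlyRational : (Dᵒᵖ ⥤ CommMonCat.{w}) → Prop}
  (C₀ : TemperedFrobenioid T D (treeCatVocab D IsRational IsStrictlyRational))

/-- At the canonical vocabulary `treeCatVocab` ("divisorial monoid on `D`" = the tree's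
`IsMonoidOn Φ ∧ Objectwise IsDivisorial Φ`), the field `isDivisorialOn` of Def 3.6 (ii) says that the
divisor monoid `Φ` of the tempered Frobenioid is a monoid on `D` in the sense of [FrdI] Def 1.1 (ii) …
[cite: MochizukiEtTh2009, Def 3.6 p.77] -/
theorem isMonoidOn_divisorMonoid : IsMonoidOn C₀.divisorMonoid :=
  ((treeCatVocab_isDivisorialOn D IsRational IsStrictlyRational _).1 C₀.isDivisorialOn).1

/-- … all of whose values `Φ(A)` are divisorial monoids ([FrdI] Def 1.1 (i)).
[cite: MochizukiEtTh2009, Def 3.6 p.77] -/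
theorem isDivisorial_divisorMonoid :
    Objectwise (fun M _ => IsDivisorial M) C₀.divisorMonoid :=
  ((treeCatVocab_isDivisorialOn D IsRational IsStrictlyRational _).1 C₀.isDivisorialOn).2

/-- **"the data `(D, Φ, B, B → Φ^gp)` determines a model Frobenioid `C` [cf. [FrdI], Theorem 5.2,
(ii)]"** (Def 3.6 (ii), p. 77; the input `hF` of Thm 3.7): at the canonical vocabulary, `C → F_Φ` IS a
Frobenioid by L1's PROVED [FrdI] Thm 5.2 (ii) `ModelFrobenioid.isFrobenioid` — `Φ` divisorial monoid
on `D` (field `isDivisorialOn`), `D` connected and totally epimorphic (fields `isConnected`,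
`isTotallyEpimorphic`), `B` group-like (`hB`) — modulo the one datum `hBmon : IsMonoidOn B` ("`𝔹` a
group-like monoid on `D`", [FrdI] Thm 5.2 preamble, kurims p. 99), a property of the pull-backs of
`B₀^Λ` not recorded in `RealifiedDivisorMonoids`. [cite: MochizukiEtTh2009, Def 3.6 p.77] -/
theorem isFrobenioid_treeCatVocab (hBmon : IsMonoidOn C₀.ratFnFunctor)
    (hB : ∀ (Y : D₀ᵒᵖ) (b : T.BΛ.obj Y), IsUnit b) :
    PreFrobenioid.IsFrobenioid C₀.toElem :=
  haveI : IsConnected D := C₀.isConnected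
  ModelFrobenioid.isFrobenioid C₀.isMonoidOn_divisorMonoid C₀.isDivisorial_divisorMonoid hBmon
    (C₀.ratFnFunctor_isGroupLike hB) ((isGraphConnected_iff_isConnected (C := D)).2 inferInstance)
    C₀.isTotallyEpimorphic

/-- **Thm 3.7 (i)**, tree-vocabulary conjuncts, at the canonical vocabulary: "of isotropic type",
"of sub-quasi-Frobenius-trivial type", "not of group-like type", from the data hypotheses `hBmon`,
`hB` alone. [cite: MochizukiEtTh2009, Thm 3.7 p.79] -/
theorem thm37_i_treeClauses_treeCatVocab (hBmon : IsMonoidOn C₀.ratFnFunctor)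
    (hB : ∀ (Y : D₀ᵒᵖ) (b : T.BΛ.obj Y), IsUnit b) :
    PreFrobenioid.IsOfIsotropicType C₀.toElem ∧
      PreFrobenioid.IsOfType (PreFrobenioid.IsSubQuasiFrobeniusTrivial C₀.toElem) ∧
      ¬ PreFrobenioid.IsOfType (PreFrobenioid.IsGroupLikeObj C₀.toElem) :=
  C₀.thm37_i_treeClauses (C₀.isFrobenioid_treeCatVocab hBmon hB) hB

/-- **Thm 3.7 (iv)** "`D` slim ⟹ `C` slim" at the canonical vocabulary, from the data hypotheses
`hBmon`, `hB` and `hdiv` (`⋂ₙ O^×(A)ⁿ = 1`) alone. [cite: MochizukiEtTh2009, Thm 3.7 p.80] -/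
theorem isSlim_category_treeCatVocab (hBmon : IsMonoidOn C₀.ratFnFunctor)
    (hB : ∀ (Y : D₀ᵒᵖ) (b : T.BΛ.obj Y), IsUnit b)
    (hdiv : ∀ (X : C₀.category) (α : Aut X), α ∈ PreFrobenioid.unitsSubgroup C₀.toElem X →
      (∀ n : ℕ+, ∃ β : Aut X, β ∈ PreFrobenioid.unitsSubgroup C₀.toElem X ∧ β ^ (n : ℕ) = α) → α = 1)
    (hD : IsSlim D) : IsSlim C₀.category :=
  C₀.isSlim_category (C₀.isFrobenioid_treeCatVocab hBmon hB) hB hdiv hD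

/-- **Thm 3.7 (iv)** as the named `Prop` `Thm37_iv`, at the canonical vocabulary, from `hBmon`, `hB`,
`hdiv` alone. [cite: MochizukiEtTh2009, Thm 3.7 p.80] -/
theorem thm37_iv_treeCatVocab (hBmon : IsMonoidOn C₀.ratFnFunctor)
    (hB : ∀ (Y : D₀ᵒᵖ) (b : T.BΛ.obj Y), IsUnit b)
    (hdiv : ∀ (X : C₀.category) (α : Aut X), α ∈ PreFrobenioid.unitsSubgroup C₀.toElem X →
      (∀ n : ℕ+, ∃ β : Aut X, β ∈ PreFrobenioid.unitsSubgroup C₀.toElem X ∧ β ^ (n : ℕ) = α) → α = 1) :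
    C₀.Thm37_iv :=
  C₀.thm37_iv (C₀.isFrobenioid_treeCatVocab hBmon hB) hB hdiv

end TreeVocab

end TemperedFrobenioid

end Literature.AnabelianGeometry.EtaleTheta
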